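import Mathlib
import Summits.Ventures.HodgeRepro.Tier4.Common.AdelicDefs
import Summits.Ventures.HodgeRepro.Tier4.Line1.TorusBlockScalar
import Summits.Ventures.HodgeRepro.Tier4.Line1.TorusElement
import Summits.Ventures.HodgeRepro.Tier4.Line1.TorusCocompact

/-!
# Tier4/Line4/ReflectionAdapted — the rational unitary reflection in `v + w` on the adapted basis of a torus datum, and
what a torus element commuting with it must be (module 1 of C-L4-CENTRE-ANISO)

Blind re-derivation cell `pub-hodge-repro`, Tier 4 «prove the step» (README §9–§10), seat t4-L4-p2 (prover, LINE L4,
gen 6; cut C-L4-CENTRE-ANISO, self-taken on the empty plate, bus S16394).  Tree path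
`lean/Summits/Ventures/HodgeRepro/Tier4/Line4/ReflectionAdapted.lean` (module 1 of 2; the cocompactness theorem is
module 2, `Line4/CentreCocompactAniso`).  Mathlib + the tree only; NO printed input; no instance; the `def`s are the
reflection matrix (adapted basis), its conjugate, its adelic unit and element, and the two line norms.

WHAT THIS PAIR PROVES (module 2 states it).  `centre_cocompact_of_anisotropic (hg : IsGenuineRow W) (hA : IsAnisotropic W) : ∃ L : Set (torusT W),
IsCompact L ∧ Z(𝔸) ⊆ Z(k) · L` — exactly the hypothesis `hZ` of typer-2's `exists_compact_centreFin_mul_of_cocompact`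
(CentreCocompact p697526: «the PRINT behind it is the cocompactness of the rational points of the anisotropic torus
`Z = U(1)_{E′/k}` in `Z(𝔸)` (Ono; Godement)»); and `exists_compact_centreFin_mul_of_anisotropic` = the `hZc` binder of
L2-p2's TailSeesawDomain (p719316) by name.  METHOD.  A central `z ∈ T(𝔸)` is `tmat ρ` for a norm-one pair `ρ` of
`E′`-scalars on the two lines `v`, `w` (L1-p5's `exists_pair_of_mem`, TorusCocompact).  The RATIONAL unitary reflection
in `u = v + w` — anisotropic by `hA` (`B(u,u) = B(v,v) + B(w,w)`, `pair_add_self`) — lies in `U(W)(𝔸_k)` (`reflElt`: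
`reflAdapted` in the adapted basis `(v, Om v, w, Om w)`, `Om`-linear, `B`-isometric, an involution; the
`isometry_of_blockScalar` template); `z` central commutes with it, and in the adapted basis `bs · R = R · bs` forces the
two scalars of `ρ` to be EQUAL (`eq_of_blockScalar_comm_reflAdapted`: the `(0,2)` and `(1,2)` entries, `2α′/(α+α′)` a unit).
An equal-pair `tmat` is the `E′`-scalar `x·1 + y·Ω` (`tmat_eq_scalar_of_eq`), central by L1-p3's
`mem_center_of_mat_eq_scalar` and in `T′` by L2-p3's `esc_mul_adMat_comm`.  hstab rung (ii) `normOneTorusCocompact d hd`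
(L1-p5, a tree theorem) writes `(x, y) = γ · c`, `γ` rational of norm one, `c` in a compact `C₀`; so
`z = torusElt (γ, γ) · torusElt (c, c)`, the first rational and central (`rationalCentreT`), the second in the compact
image `L` of the diagonal pairs over `C₀` under the continuous `torusElt`.

WHAT IS IN THIS MODULE: `reflAdapted`, `reflAdapted_comm_omegaJ`, `reflAdapted_mul_self`, `reflAdapted_isometry`,
`omegaJ_map`, `eq_of_blockScalar_comm_reflAdapted` (generic, over a field); `dataAlpha`, `dataAlpha'`, `reflConj`,
`reflConj_props`, `reflUnit`, `reflUnit_mem`, `reflElt`, `mat_reflElt`, `eq_of_tmat_comm_reflConj`, `tmat_eq_scalar_of_eq`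
(on a torus datum of a plane).  READING FOR THE LINE.  The (7b) residual of record lists `hZc` as a print input (lit-5 row I-t4-lit-5-67, Ono/Godement);
on the wall's seesaw plane (anisotropic by SeesawAnisotropic under the dictionary, genuine by
`isGenuineRow_seesawPlane`) it is now a theorem by name — the printed counterpart stays the literature's, nothing of it
is consumed.  Nothing here says anything about the status of the Hodge conjecture for CM abelian varieties, which is
NOT proved; HC_CM is NOT proved by anyone in this repository.
-/

set_option autoImplicit false

noncomputable section

namespace Summit.Ventures.HodgeRepro.Tier4.Line4

open Matrix Summit.Ventures.HodgeRepro.Tier4.Common Summit.Ventures.HodgeRepro.Tier4.Line1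
  Summit.Ventures.HodgeRepro.Tier4.Line1.Rot
open scoped Pointwise

section ReflGeneric

variable {k : Type} [Field k]

/-- **the unitary reflection in `v + w` on the adapted basis** `(v, Om v, w, Om w)` of two orthogonal `E′`-lines with
`B`-norms `α = B(v,v)`, `α′ = B(w,w)`: `x ↦ x − 2 h(x, u)/h(u, u) · u` for `u = v + w` reads, on pairs of scalars
`(x₁ + y₁ω, x₂ + y₂ω)`, as `1 − s · [[α, 0, α′, 0], [0, α, 0, α′], [α, 0, α′, 0], [0, α, 0, α′]]`, `s = 2/(α + α′)`. -/
def reflAdapted (α α' : k) : Matrix (Fin 4) (Fin 4) k :=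
  Matrix.of ![![1 - 2 * α / (α + α'), 0, -(2 * α' / (α + α')), 0],
    ![0, 1 - 2 * α / (α + α'), 0, -(2 * α' / (α + α'))],
    ![-(2 * α / (α + α')), 0, 1 - 2 * α' / (α + α'), 0],
    ![0, -(2 * α / (α + α')), 0, 1 - 2 * α' / (α + α')]]

/-- the reflection commutes with `diag(J, J)` (it is `E′`-linear). -/
theorem reflAdapted_comm_omegaJ (d α α' : k) :
    reflAdapted α α' * omegaJ d = omegaJ d * reflAdapted α α' := by
  ext i j
  fin_cases i <;> fin_cases j <;> simp [reflAdapted, omegaJ, Matrix.mul_apply, Fin.sum_univ_four] <;> ring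

/-- the reflection is an involution. -/
theorem reflAdapted_mul_self (α α' : k) (hs : α + α' ≠ 0) :
    reflAdapted α α' * reflAdapted α α' = 1 := by
  ext i j
  fin_cases i <;> fin_cases j <;>
    simp [reflAdapted, Matrix.mul_apply, Fin.sum_univ_four] <;>
    field_simp <;> ring

/-- the reflection is an isometry of the Gram matrix `diag(α, dα, α′, dα′)`. -/
theorem reflAdapted_isometry (d α α' : k) (hs : α + α' ≠ 0) :
    (reflAdapted α α')ᵀ * Matrix.diagonal ![α, d * α, α', d * α'] * reflAdapted α α' =
      Matrix.diagonal ![α, d * α, α', d * α'] := by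
  ext i j
  fin_cases i <;> fin_cases j <;>
    simp [reflAdapted, Matrix.mul_apply, Fin.sum_univ_four, Matrix.diagonal, Matrix.transpose_apply] <;>
    field_simp <;> ring

/-- `omegaJ` transports along a ring homomorphism. -/
theorem omegaJ_map {R : Type} [CommRing R] (ι : k →+* R) (d : k) : (omegaJ d).map ι = omegaJ (ι d) := by
  ext i j
  fin_cases i <;> fin_cases j <;> simp [omegaJ]

/-- **a block scalar commuting with the reflection has EQUAL scalars**: from the `(0,2)` and `(1,2)` entries of
`bs · R = R · bs`, `(2α′/(α+α′)) · (x − x′) = 0` and `(2α′/(α+α′)) · (y − y′) = 0`, and `2α′/(α+α′)` is a unit of `R`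
(the image of a non-zero element of `k`). -/
theorem eq_of_blockScalar_comm_reflAdapted [CharZero k] {R : Type} [CommRing R] (ι : k →+* R) (d α α' : k)
    (hα' : α' ≠ 0) (hs : α + α' ≠ 0) (x y x' y' : R)
    (h : blockScalar (ι d) x y x' y' * (reflAdapted α α').map ι =
      (reflAdapted α α').map ι * blockScalar (ι d) x y x' y') :
    x = x' ∧ y = y' := by
  have ht : (2 * α' / (α + α')) ≠ 0 := by
    apply div_ne_zero _ hs
    exact mul_ne_zero two_ne_zero hα'
  have h1 : ι (2 * α' / (α + α'))⁻¹ * ι (2 * α' / (α + α')) = 1 := by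
    rw [← map_mul, inv_mul_cancel₀ ht, map_one]
  have hunit : ∀ u u' : R, ι (2 * α' / (α + α')) * u = ι (2 * α' / (α + α')) * u' → u = u' := by
    intro u u' huu
    calc u = (ι (2 * α' / (α + α'))⁻¹ * ι (2 * α' / (α + α'))) * u := by rw [h1, one_mul]
      _ = ι (2 * α' / (α + α'))⁻¹ * (ι (2 * α' / (α + α')) * u) := by rw [mul_assoc]
      _ = ι (2 * α' / (α + α'))⁻¹ * (ι (2 * α' / (α + α')) * u') := by rw [huu]
      _ = (ι (2 * α' / (α + α'))⁻¹ * ι (2 * α' / (α + α'))) * u' := by rw [mul_assoc]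
      _ = u' := by rw [h1, one_mul]
  have h02 := congrFun (congrFun h 0) 2
  have h12 := congrFun (congrFun h 1) 2
  simp [blockScalar, reflAdapted, Matrix.mul_apply, Fin.sum_univ_four, Matrix.map_apply] at h02 h12
  refine ⟨hunit _ _ ?_, hunit _ _ ?_⟩
  · linear_combination h02
  · linear_combination h12

end ReflGeneric

section ReflData

variable {k : Type} [Field k] [NumberField k] {W : PlaneData k}

/-- the `B`-norm `α = B(v, v)` of the first line vector of the data -/
abbrev dataAlpha (D : TorusData k) : k := D.v ⬝ᵥ (D.B *ᵥ D.v)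

/-- the `B`-norm `α′ = B(w, w)` of the second line vector of the data -/
abbrev dataAlpha' (D : TorusData k) : k := D.w ⬝ᵥ (D.B *ᵥ D.w)

/-- **the reflection in `v + w` on the data, over `𝔸_k`, in the conjugated form** `S · R · S⁻¹` -/
def reflConj (D : TorusData k) : M4 k :=
  D.S.map (algebraMap k (Ad k)) * (reflAdapted (dataAlpha D) (dataAlpha' D)).map (algebraMap k (Ad k)) *
    (D.S⁻¹).map (algebraMap k (Ad k))

/-- the three invariance properties of the conjugated reflection (column picture): `Om`-commutation, `B`-isometry,
involution — the `isometry_of_blockScalar` template with `blockScalar` replaced by `reflAdapted`. -/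
theorem reflConj_props (D : TorusData k) (hs : dataAlpha D + dataAlpha' D ≠ 0) :
    reflConj D * D.Om.map (algebraMap k (Ad k)) = D.Om.map (algebraMap k (Ad k)) * reflConj D ∧
    (reflConj D)ᵀ * D.B.map (algebraMap k (Ad k)) * reflConj D = D.B.map (algebraMap k (Ad k)) ∧
    reflConj D * reflConj D = 1 := by
  obtain ⟨hRR, hRR', hOmR, -, hGR', -, -, -⟩ := D.setup (algebraMap k (Ad k))
  set ι := algebraMap k (Ad k) with hι
  set SR : M4 k := D.S.map ι with hSR
  set SR' : M4 k := (D.S⁻¹).map ι with hSR'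
  set Rm : M4 k := (reflAdapted (dataAlpha D) (dataAlpha' D)).map ι with hRm
  have hOm' : D.Om.map ι = SR * omegaJ (ι D.d) * SR' := by
    rw [← hOmR, Matrix.mul_assoc, hRR, Matrix.mul_one]
  have hB' : D.B.map ι = SR'ᵀ * Matrix.diagonal ![ι (dataAlpha D), ι D.d * ι (dataAlpha D), ι (dataAlpha' D), ι D.d * ι (dataAlpha' D)] * SR' := by
    rw [← hGR']
    calc D.B.map ι = (SR'ᵀ * SRᵀ) * D.B.map ι * (SR * SR') := by
          rw [← Matrix.transpose_mul, hRR, Matrix.transpose_one, Matrix.one_mul, Matrix.mul_one]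
      _ = SR'ᵀ * (SRᵀ * D.B.map ι * SR) * SR' := by simp only [Matrix.mul_assoc]
  have h1 : SRᵀ * SR'ᵀ = 1 := by rw [← Matrix.transpose_mul, hRR', Matrix.transpose_one]
  -- the adapted identities, transported along `ι`
  have hRO : Rm * omegaJ (ι D.d) = omegaJ (ι D.d) * Rm := by
    rw [hRm, ← omegaJ_map ι D.d, ← Matrix.map_mul, ← Matrix.map_mul, reflAdapted_comm_omegaJ]
  have hRR2 : Rm * Rm = 1 := by
    rw [hRm, ← Matrix.map_mul, reflAdapted_mul_self _ _ hs, Matrix.map_one ι (map_zero ι) (map_one ι)]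
  have hRG : Rmᵀ * Matrix.diagonal ![ι (dataAlpha D), ι D.d * ι (dataAlpha D), ι (dataAlpha' D), ι D.d * ι (dataAlpha' D)] * Rm =
      Matrix.diagonal ![ι (dataAlpha D), ι D.d * ι (dataAlpha D), ι (dataAlpha' D), ι D.d * ι (dataAlpha' D)] := by
    have hdiag : Matrix.diagonal ![ι (dataAlpha D), ι D.d * ι (dataAlpha D), ι (dataAlpha' D), ι D.d * ι (dataAlpha' D)] =
        (Matrix.diagonal ![dataAlpha D, D.d * dataAlpha D, dataAlpha' D, D.d * dataAlpha' D]).map ι := by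
      rw [Matrix.diagonal_map (map_zero ι)]
      congr 1
      funext i
      fin_cases i <;> simp
    rw [hdiag, hRm, ← Matrix.transpose_map, ← Matrix.map_mul, ← Matrix.map_mul, reflAdapted_isometry _ _ _ hs]
  refine ⟨?_, ?_, ?_⟩
  · calc SR * Rm * SR' * D.Om.map ι = SR * Rm * (SR' * SR) * omegaJ (ι D.d) * SR' := by
          rw [hOm']; simp only [Matrix.mul_assoc]
      _ = SR * (Rm * omegaJ (ι D.d)) * SR' := by rw [hRR', Matrix.mul_one]; simp only [Matrix.mul_assoc]
      _ = SR * (omegaJ (ι D.d) * Rm) * SR' := by rw [hRO]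
      _ = SR * omegaJ (ι D.d) * (SR' * SR) * Rm * SR' := by rw [hRR', Matrix.mul_one]; simp only [Matrix.mul_assoc]
      _ = D.Om.map ι * (SR * Rm * SR') := by rw [hOm']; simp only [Matrix.mul_assoc]
  · calc (SR * Rm * SR')ᵀ * D.B.map ι * (SR * Rm * SR')
        = SR'ᵀ * Rmᵀ * (SRᵀ * SR'ᵀ) * Matrix.diagonal ![ι (dataAlpha D), ι D.d * ι (dataAlpha D), ι (dataAlpha' D), ι D.d * ι (dataAlpha' D)] *
            (SR' * SR) * Rm * SR' := by
          rw [hB', Matrix.transpose_mul, Matrix.transpose_mul]; simp only [Matrix.mul_assoc]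
      _ = SR'ᵀ * (Rmᵀ * Matrix.diagonal ![ι (dataAlpha D), ι D.d * ι (dataAlpha D), ι (dataAlpha' D), ι D.d * ι (dataAlpha' D)] * Rm) * SR' := by
          rw [h1, hRR', Matrix.mul_one, Matrix.mul_one]
          simp only [Matrix.mul_assoc]
      _ = D.B.map ι := by rw [hRG, hB']
  · calc SR * Rm * SR' * (SR * Rm * SR') = SR * Rm * (SR' * SR) * Rm * SR' := by simp only [Matrix.mul_assoc]
      _ = SR * (Rm * Rm) * SR' := by rw [hRR', Matrix.mul_one]; simp only [Matrix.mul_assoc]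
      _ = 1 := by rw [hRR2, Matrix.mul_one, hRR]

end ReflData

section ReflElt

variable {k : Type} [Field k] [NumberField k] {W : PlaneData k}

/-- **the reflection as an adelic unit** (row picture `(S · R · S⁻¹)ᵀ`, its own inverse). -/
def reflUnit (D : TorusData k) (hs : dataAlpha D + dataAlpha' D ≠ 0) : GL4 k :=
  ⟨(reflConj D)ᵀ, (reflConj D)ᵀ,
    by rw [← Matrix.transpose_mul, (reflConj_props D hs).2.2, Matrix.transpose_one],
    by rw [← Matrix.transpose_mul, (reflConj_props D hs).2.2, Matrix.transpose_one]⟩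

/-- the reflection lies in `U(W)(𝔸_k)` (the `torusUnit_mem` pattern). -/
theorem reflUnit_mem (D : TorusData k) (hDB : D.B = W.B) (hDOm : D.Om = W.Ωᵀ)
    (hs : dataAlpha D + dataAlpha' D ≠ 0) : reflUnit D hs ∈ unitaryGroup W := by
  obtain ⟨h1, h2, -⟩ := reflConj_props D hs
  refine (mem_unitaryGroup W _).mpr ⟨?_, ?_⟩
  · show (reflConj D)ᵀ * adMat k W.Ω = adMat k W.Ω * (reflConj D)ᵀ
    have hΩ : (D.Om.map (algebraMap k (Ad k)))ᵀ = adMat k W.Ω := by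
      rw [hDOm, ← Matrix.transpose_map, Matrix.transpose_transpose]
      rfl
    rw [← hΩ, ← Matrix.transpose_mul, ← Matrix.transpose_mul, h1]
  · show (reflConj D)ᵀ * adMat k W.B * (reflConj D)ᵀᵀ = adMat k W.B
    have hB : D.B.map (algebraMap k (Ad k)) = adMat k W.B := by rw [hDB]; rfl
    rw [Matrix.transpose_transpose, ← hB]
    exact h2

/-- **the rational unitary reflection in `v + w`, as an element of `U(W)(𝔸_k)`.** -/
def reflElt (D : TorusData k) (hDB : D.B = W.B) (hDOm : D.Om = W.Ωᵀ)
    (hs : dataAlpha D + dataAlpha' D ≠ 0) : GA W :=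
  ⟨reflUnit D hs, reflUnit_mem D hDB hDOm hs⟩

/-- the matrix of the reflection element -/
theorem mat_reflElt (D : TorusData k) (hDB : D.B = W.B) (hDOm : D.Om = W.Ωᵀ)
    (hs : dataAlpha D + dataAlpha' D ≠ 0) : GA.mat W (reflElt D hDB hDOm hs) = (reflConj D)ᵀ := rfl

/-- **a torus element commuting with the reflection has EQUAL scalars** (`tmat` level). -/
theorem eq_of_tmat_comm_reflConj (D : TorusData k) (hα' : dataAlpha' D ≠ 0)
    (hs : dataAlpha D + dataAlpha' D ≠ 0) (ρ : Fin 4 → Ad k)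
    (h : D.tmat (algebraMap k (Ad k)) ρ * (reflConj D)ᵀ = (reflConj D)ᵀ * D.tmat (algebraMap k (Ad k)) ρ) :
    ρ 0 = ρ 2 ∧ ρ 1 = ρ 3 := by
  obtain ⟨hRR, hRR', -, -, -, -, -, -⟩ := D.setup (algebraMap k (Ad k))
  set ι := algebraMap k (Ad k) with hι
  set SR : M4 k := D.S.map ι with hSR
  set SR' : M4 k := (D.S⁻¹).map ι with hSR'
  set Rm : M4 k := (reflAdapted (dataAlpha D) (dataAlpha' D)).map ι with hRm
  set bs : M4 k := blockScalar (ι D.d) (ρ 0) (ρ 1) (ρ 2) (ρ 3) with hbs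
  have hRc : reflConj D = SR * Rm * SR' := rfl
  have htm : D.tmat ι ρ = (SR * bs * SR')ᵀ := D.tmat_eq_transpose ι ρ
  -- transpose the commutation
  have h0 : (SR * bs * SR')ᵀ * (SR * Rm * SR')ᵀ = (SR * Rm * SR')ᵀ * (SR * bs * SR')ᵀ := by
    rw [← htm, ← hRc]; exact h
  rw [← Matrix.transpose_mul, ← Matrix.transpose_mul] at h0
  have h' : (SR * Rm * SR') * (SR * bs * SR') = (SR * bs * SR') * (SR * Rm * SR') := by
    have := congrArg Matrix.transpose h0
    simpa only [Matrix.transpose_transpose] using this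
  have cancel : ∀ X : M4 k, SR' * (SR * X * SR') * SR = X := by
    intro X
    calc SR' * (SR * X * SR') * SR = (SR' * SR) * X * (SR' * SR) := by simp only [Matrix.mul_assoc]
      _ = X := by rw [hRR', Matrix.one_mul, Matrix.mul_one]
  have key : Rm * bs = bs * Rm := by
    have e1 : (SR * Rm * SR') * (SR * bs * SR') = SR * (Rm * bs) * SR' := by
      calc (SR * Rm * SR') * (SR * bs * SR') = SR * Rm * (SR' * SR) * bs * SR' := by simp only [Matrix.mul_assoc]
        _ = SR * (Rm * bs) * SR' := by rw [hRR', Matrix.mul_one]; simp only [Matrix.mul_assoc]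
    have e2 : (SR * bs * SR') * (SR * Rm * SR') = SR * (bs * Rm) * SR' := by
      calc (SR * bs * SR') * (SR * Rm * SR') = SR * bs * (SR' * SR) * Rm * SR' := by simp only [Matrix.mul_assoc]
        _ = SR * (bs * Rm) * SR' := by rw [hRR', Matrix.mul_one]; simp only [Matrix.mul_assoc]
    rw [e1, e2] at h'
    have := congrArg (fun X => SR' * X * SR) h'
    simpa only [cancel] using this
  exact eq_of_blockScalar_comm_reflAdapted ι D.d _ _ hα' hs _ _ _ _ key.symm

/-- **a torus element with equal scalars is the `E′`-scalar `x + yΩ`** (row picture: `x·1 + y·adMat Ω`). -/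
theorem tmat_eq_scalar_of_eq (D : TorusData k) (hDOm : D.Om = W.Ωᵀ) (ρ : Fin 4 → Ad k)
    (h02 : ρ 0 = ρ 2) (h13 : ρ 1 = ρ 3) :
    D.tmat (algebraMap k (Ad k)) ρ = ρ 0 • (1 : M4 k) + ρ 1 • adMat k W.Ω := by
  obtain ⟨hRR, hRR', hOmR, -, -, -, -, -⟩ := D.setup (algebraMap k (Ad k))
  set ι := algebraMap k (Ad k) with hι
  set SR : M4 k := D.S.map ι with hSR
  set SR' : M4 k := (D.S⁻¹).map ι with hSR'
  have hbs : blockScalar (ι D.d) (ρ 0) (ρ 1) (ρ 2) (ρ 3) = ρ 0 • (1 : M4 k) + ρ 1 • omegaJ (ι D.d) := by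
    rw [← h02, ← h13]
    ext i j
    fin_cases i <;> fin_cases j <;> simp [blockScalar, omegaJ] <;> ring
  have hOm' : SR * omegaJ (ι D.d) * SR' = D.Om.map ι := by
    rw [← hOmR, Matrix.mul_assoc, hRR, Matrix.mul_one]
  have hΩ : (D.Om.map ι)ᵀ = adMat k W.Ω := by
    rw [hDOm, ← Matrix.transpose_map, Matrix.transpose_transpose]
    rfl
  rw [D.tmat_eq_transpose, hbs, Matrix.mul_add, Matrix.add_mul, Matrix.mul_smul, Matrix.smul_mul, Matrix.mul_one, hRR,
    Matrix.mul_smul, Matrix.smul_mul, hOm', Matrix.transpose_add, Matrix.transpose_smul, Matrix.transpose_smul,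
    Matrix.transpose_one, hΩ]

end ReflElt

end Summit.Ventures.HodgeRepro.Tier4.Line4

end
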